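import Summits.KontsevichZagierPeriods.KontsevichZagierPeriods.Theorems.CompleteModGammaSector.Negative.LoadBearing

/-!
# `CompleteModGammaSector` (stmt-KontsevichZagierPeriods-14233) — residual absorption

Bookkeeping for the line protocol of this crux (Conjecture 1 of Kontsevich–Zagier for the
Γ-enlarged calculus; kernel form `ker eval ≤ sector`,
`CompleteModGammaSectorNegative.completeModGammaSector_iff_ker_le`).

Every proof line tried on this crux (wronskian transport, Wolfart/Huber–Wüstholz, cusp transport,
Hodge-locus cobordism) has the shape "prove a LEVER `S` — a subgroup of new identities — and leave
the RESIDUAL `ker eval ≤ sector ⊔ S`". The lemmas below record, once and for all levers, that a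
lever lying inside the sector (in particular any lever proved absolutely, `S ≤ relations`, or
modulo the Γ-Hodge pairs, `S ≤ sector`) is ABSORBED: `sector ⊔ S = sector`, so the residual is
literally equivalent to the crux. Contrapositively, a line whose residual is strictly weaker than
the crux must posit generators outside the sector, i.e. new unproved pairs. The special case
`S ≤ relations` for the Elliott–cusp lever is
`CompleteModGammaSectorCuspLine.completeModGammaSector_iff_residual_of_le_relations`.
-/

noncomputable section

-- `Summit.KontsevichZagierPeriods.KontsevichZagierPeriods.…` is the tree's mandated layout (single-conjunct summit).
set_option linter.dupNamespace false

namespace Summit.KontsevichZagierPeriods.KontsevichZagierPeriods.CompleteModGammaSectorResidualAbsorption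

open Literature.NumberTheory.Transcendental
open Literature.NumberTheory.Transcendental.KZ
open Summit.KontsevichZagierPeriods.KontsevichZagierPeriods.Theses.TerasomaMultiplication
  (CompleteModGammaSector)
open Summit.KontsevichZagierPeriods.CompleteModGammaSectorNegative
  (sector completeModGammaSector_iff_ker_le)

/-- A lever inside the sector is absorbed by it: `sector ⊔ S = sector` for `S ≤ sector`.
[folklore] -/
theorem sector_sup_eq_of_le {S : AddSubgroup FormalRep} (hS : S ≤ sector) : sector ⊔ S = sector :=
  sup_eq_left.mpr hS

/-- **Residual absorption.** For every subgroup `S ≤ sector` the crux `CompleteModGammaSector` is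
equivalent to the residual `ker eval ≤ sector ⊔ S` that a line proving the lever `S` leaves behind:
no lever inside the sector weakens the crux. [cite: KontsevichZagier2001, §1.2 Conjecture 1] -/
theorem completeModGammaSector_iff_residual_of_le_sector : ∀ S : AddSubgroup FormalRep, S ≤ sector → (CompleteModGammaSector ↔ eval.ker ≤ sector ⊔ S) := by
  intro S hS
  rw [completeModGammaSector_iff_ker_le, sector_sup_eq_of_le hS]

/-- Residual absorption for a lever given by a generating SET of identities inside the sector
(the form in which line skeletons state their residual stubs, `sector ⊔ closure T`).
[cite: KontsevichZagier2001, §1.2 Conjecture 1] -/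
theorem completeModGammaSector_iff_residual_of_subset_sector (T : Set FormalRep)
    (hT : T ⊆ sector) : CompleteModGammaSector ↔ eval.ker ≤ sector ⊔ AddSubgroup.closure T :=
  completeModGammaSector_iff_residual_of_le_sector _ ((AddSubgroup.closure_le _).mpr hT)

/-- Residual absorption for any family of levers inside the sector at once (several lines merged).
[cite: KontsevichZagier2001, §1.2 Conjecture 1] -/
theorem completeModGammaSector_iff_residual_iSup {ι : Sort*} (S : ι → AddSubgroup FormalRep)
    (hS : ∀ i, S i ≤ sector) : CompleteModGammaSector ↔ eval.ker ≤ sector ⊔ ⨆ i, S i :=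
  completeModGammaSector_iff_residual_of_le_sector _ (iSup_le hS)

/-- Contrapositive bookkeeping: if a residual `ker eval ≤ sector ⊔ S` holds while the crux fails,
then the lever `S` is NOT inside the sector — a line whose residual is genuinely weaker than the
crux posits identities outside `relations ⊔ closure (Γ-pairs)`. [folklore] -/
theorem not_le_sector_of_residual (S : AddSubgroup FormalRep) (hres : eval.ker ≤ sector ⊔ S)
    (hnot : ¬ CompleteModGammaSector) : ¬ S ≤ sector :=
  fun hS => hnot ((completeModGammaSector_iff_residual_of_le_sector S hS).mpr hres)

end Summit.KontsevichZagierPeriods.KontsevichZagierPeriods.CompleteModGammaSectorResidualAbsorption
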